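import Summits.RiemannHypothesis.RiemannHypothesis.Theses.GapsEvoDoors
import Summits.RiemannHypothesis.RiemannHypothesis.Theorems.GapsEvoDoorsFFMultiplicityCriterionAll
import Summits.RiemannHypothesis.RiemannHypothesis.Theorems.GapsEvoDoorsMultCertificateRecord
import Summits.RiemannHypothesis.RiemannHypothesis.Theorems.GapsEvoDoorsSimpleFromNStar

/-!
# GapsEvoDoors — `FragmentToSimpleRecord` (item stmt-RiemannHypothesis-23132): door (a″) record line, composed

Route `GapsEvoDoors`, aside `FragmentToSimpleRecord` («Δ_s» line of record, PREREG-GAPS-7 A2,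
RECORD class): RH + the pair-correlation fragment `F → 1` on `1 < |α| ≤ 53/50` (every tolerance)
⇒ for every `η > 0`, eventually `N⁽¹⁾(T) ≥ (704/1000 − η) N(T)` (at least 70.4 % of the zeros are
simple and on the critical line; Bui–Heath-Brown's RH record is `19/27 = 70.37 %`). Pure composition
of three tree theorems of this route: `FFMultiplicityCriterionAll_holds` (Montgomery's `N*` argument
under the fragment), `MultCertificateRecord_holds` (the Montgomery–Taylor cosine majorant at window
`53/50`: `m(g; 53/50, ε) ≤ 1.293 + κε`) and `SimpleFromNStar_holds` (`N⁽¹⁾ ≥ 2N − N*`): with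
`ε = η/(3(κ + 1))` and slack `η/3` twice, `N* ≤ (1.293 + κε + η/3)N` and
`N⁽¹⁾ ≥ (2 − 1.293 − κε − 2η/3)N ≥ (0.704 − η)N`. RH and the fragment are antecedents.
RH-sentence (c): a record INSIDE route GapsEvoDoors (door (a″), RECORD class, never a CI trigger) —
toward RiemannHypothesis: 0. Nothing here bears on the truth of RH.
-/

noncomputable section

open Filter Set MeasureTheory Real Literature.NumberTheory.LFunctions
open Literature.NumberTheory.LFunctions.BGMM2023

set_option linter.dupNamespace false  -- the mandated namespace repeats `RiemannHypothesis`

namespace Summit.RiemannHypothesis.RiemannHypothesis.Theorems.GapsEvoDoorsSimpleRecord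

/-- **`FragmentToSimpleRecord` holds** (item stmt-RiemannHypothesis-23132 of route GapsEvoDoors):
RH + `F → 1` on `(1, 53/50]` ⇒ `N⁽¹⁾(T) ≥ (0.704 − η) N(T)` eventually, for every `η > 0` —
`FFMultiplicityCriterionAll_holds` + `MultCertificateRecord_holds` + `SimpleFromNStar_holds`.
A record INSIDE the route (door (a″)); toward RiemannHypothesis: 0. -/
theorem FragmentToSimpleRecord_holds :
    Summit.RiemannHypothesis.RiemannHypothesis.Theses.GapsEvoDoors.FragmentToSimpleRecord := by
  unfold Summit.RiemannHypothesis.RiemannHypothesis.Theses.GapsEvoDoors.FragmentToSimpleRecord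
  intro hFF hRH η hη
  have hM := GapsEvoDoorsMultCert.MultCertificateRecord_holds
  unfold Summit.RiemannHypothesis.RiemannHypothesis.Theses.GapsEvoDoors.MultCertificateRecord at hM
  obtain ⟨g, hev, hco, hin, hti, hg0, hg1, htail, κ, hκ, hcert⟩ := hM
  have hcrit := GapsEvoDoorsFF.FFMultiplicityCriterionAll_holds
  unfold Summit.RiemannHypothesis.RiemannHypothesis.Theses.GapsEvoDoors.FFMultiplicityCriterionAll
    at hcrit
  have hsimple := GapsEvoDoorsSimple.SimpleFromNStar_holds
  unfold Summit.RiemannHypothesis.RiemannHypothesis.Theses.GapsEvoDoors.SimpleFromNStar at hsimple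
  -- the tolerance `ε = η/(3(κ + 1))`, so that `κ ε ≤ η/3`
  set ε : ℝ := η / (3 * (κ + 1)) with hεdef
  have hε0 : 0 < ε := by positivity
  have hκε : κ * ε ≤ η / 3 := by
    rw [hεdef, show κ * (η / (3 * (κ + 1))) = η / 3 * (κ / (κ + 1)) by field_simp]
    exact mul_le_of_le_one_right (by positivity) ((div_le_one (by positivity)).2 (by linarith))
  -- `N*(T) ≤ (m(g; 53/50, ε) + η/3) N(T) ≤ ν N(T)`
  obtain ⟨T₀, hT₀⟩ := hcrit (53 / 50) ε (by norm_num) hε0.le (hFF ε hε0) hRH g hev hco hin hti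
    hg0 hg1 htail (η / 3) (by positivity)
  have hm := hcert ε hε0.le
  set ν : ℝ := 1293 / 1000 + κ * ε + η / 3 with hνdef
  have hN : ∃ T₀ : ℝ, ∀ T : ℝ, T₀ ≤ T →
      (multPairCount T : ℝ) ≤ ν * zetaZeroCount T := by
    refine ⟨T₀, fun T hT ↦ (hT₀ T hT).trans ?_⟩
    exact mul_le_mul_of_nonneg_right (by rw [hνdef]; linarith) (Nat.cast_nonneg _)
  -- `N⁽¹⁾ ≥ (2 − ν − η/3) N ≥ (0.704 − η) N`
  filter_upwards [hsimple hRH ν hN (η / 3) (by positivity)] with T hT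
  have hN0 : (0 : ℝ) ≤ zetaZeroCount T := Nat.cast_nonneg _
  have hle : 704 / 1000 - η ≤ 2 - ν - η / 3 := by rw [hνdef]; linarith
  exact (mul_le_mul_of_nonneg_right hle hN0).trans hT

end Summit.RiemannHypothesis.RiemannHypothesis.Theorems.GapsEvoDoorsSimpleRecord

end
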